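import Summits.QuantumFields.YangMills.Theorems.PencilRigidityWeakCouplingHypercubicLimitStubTimeSlicing
import Summits.QuantumFields.YangMills.Theorems.PencilRigidityWeakCouplingHypercubicLimitStubSliceKernel
import Summits.QuantumFields.YangMills.Theorems.PencilRigidityWeakCouplingHypercubicLimitStubSlabContraction
import Summits.QuantumFields.YangMills.Theorems.PencilRigidityWeakCouplingHypercubicLimitStubSpectralData
import Summits.QuantumFields.YangMills.Theorems.PencilRigidityWeakCouplingHypercubicLimitStubFiniteTruncation
import Literature.MathematicalPhysics.QuantumFieldTheory.YangMillsOS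
import Literature.MathematicalPhysics.QuantumFieldTheory.WilsonTransferKernel
import Literature.MathematicalPhysics.QuantumFieldTheory.SlabTransferKernel
import Literature.MathematicalPhysics.QuantumFieldTheory.TorusFreeTransfer
import Literature.MathematicalPhysics.QuantumFieldTheory.LatticeGaugeProofs
import Literature.MathematicalPhysics.QuantumLattice.GaugeGroups
import Literature.MathematicalPhysics.QuantumLattice.LatticeGaugeDLR
import HarnessLib

/-!
# Stub `stub_transferRepresentation` (S6a, the glue) for the crux `WeakCouplingHypercubicLimit` (line `Sketch`)

Torus Wilson expectations are normalised transfer traces of finite positive models (Osterwalder–Seiler 1978 §§2–3,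
Lüscher 1977): assembled from the landed stubs T1 `stub_timeSlicing`, T2 `stub_sliceKernel`, T4 `stub_slabContraction`,
T3a `stub_spectralData`, T3b `stub_finiteTruncation` via `latticeConnectedCorr` as a ratio of sliced Haar integrals
(`wilsonExpectation_eq_div_integral`), the cylinder property of the observables (time support in `[−R, R]`, blocks of
`2R + 1` bonds, `w = 2R + 2`), a rotation of the time cycle by `R`, `∫ c dν = wilsonSliceKernel`, and the absorption of
one factor `T` into `Ao`, `Bo`.  Helper lemmas: `integral_rotate_cycle`, `exists_timeBound`,
`val_intCast_of_nonneg_lt`, `prod_rotate_cycle`, `exp_neg_mul_sum_eq_prod`. [folklore]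
-/

noncomputable section

open scoped BigOperators Topology InnerProductSpace
open MeasureTheory Filter
open Literature.MathematicalPhysics.QuantumFieldTheory Literature.MathematicalPhysics.QuantumLattice
open Literature.MathematicalPhysics.AQFT

namespace Summit.QuantumFields.YangMills.Theorems.WeakCouplingHypercubicLimit.TraceNormColdPressure

/-! ### Helper lemmas -/

/-- Relabelling the time cycle by a translation preserves the product of the two slice measures. [folklore] -/
theorem integral_rotate_cycle {N : ℕ} [NeZero N] {X Y : Type*} [MeasurableSpace X] [MeasurableSpace Y]
    (μ : Measure X) (ν : Measure Y) [SigmaFinite μ] [SigmaFinite ν] [SFinite (Measure.pi fun _ : ZMod N => μ)]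
    [SFinite (Measure.pi fun _ : ZMod N => ν)] (c₀ : ZMod N)
    (F : (ZMod N → X) × (ZMod N → Y) → ℝ) :
    ∫ q, F (fun τ => q.1 (τ + c₀), fun τ => q.2 (τ + c₀)) ∂((Measure.pi fun _ : ZMod N => μ).prod (Measure.pi fun _ : ZMod N => ν)) =
      ∫ p, F p ∂((Measure.pi fun _ : ZMod N => μ).prod (Measure.pi fun _ : ZMod N => ν)) := by
  set eX := MeasurableEquiv.piCongrLeft (fun _ : ZMod N => X) (Equiv.addRight c₀).symm with heX
  set eY := MeasurableEquiv.piCongrLeft (fun _ : ZMod N => Y) (Equiv.addRight c₀).symm with heY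
  have hX : MeasurePreserving eX (Measure.pi fun _ : ZMod N => μ) (Measure.pi fun _ : ZMod N => μ) :=
    measurePreserving_piCongrLeft (fun _ : ZMod N => μ) (Equiv.addRight c₀).symm
  have hY : MeasurePreserving eY (Measure.pi fun _ : ZMod N => ν) (Measure.pi fun _ : ZMod N => ν) :=
    measurePreserving_piCongrLeft (fun _ : ZMod N => ν) (Equiv.addRight c₀).symm
  have heXa : ∀ V : ZMod N → X, eX V = fun τ => V (τ + c₀) := fun V => by
    funext i
    simp only [heX, MeasurableEquiv.coe_piCongrLeft, Equiv.piCongrLeft_apply_eq_cast, cast_eq, Equiv.symm_symm,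
      Equiv.coe_addRight]
  have heYa : ∀ V : ZMod N → Y, eY V = fun τ => V (τ + c₀) := fun V => by
    funext i
    simp only [heY, MeasurableEquiv.coe_piCongrLeft, Equiv.piCongrLeft_apply_eq_cast, cast_eq, Equiv.symm_symm,
      Equiv.coe_addRight]
  have h' : MeasurePreserving (MeasurableEquiv.prodCongr eX eY)
      ((Measure.pi fun _ : ZMod N => μ).prod (Measure.pi fun _ : ZMod N => ν))
      ((Measure.pi fun _ : ZMod N => μ).prod (Measure.pi fun _ : ZMod N => ν)) := hX.prod hY
  have happ : ∀ q : (ZMod N → X) × (ZMod N → Y),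
      (MeasurableEquiv.prodCongr eX eY) q = (fun τ => q.1 (τ + c₀), fun τ => q.2 (τ + c₀)) := by
    intro q
    show Prod.map eX eY q = _
    rw [Prod.map_apply, heXa, heYa]
  calc ∫ q, F (fun τ => q.1 (τ + c₀), fun τ => q.2 (τ + c₀)) ∂((Measure.pi fun _ : ZMod N => μ).prod (Measure.pi fun _ : ZMod N => ν)) = ∫ q, F ((MeasurableEquiv.prodCongr eX eY) q)
            ∂((Measure.pi fun _ : ZMod N => μ).prod (Measure.pi fun _ : ZMod N => ν)) := by
          simp only [happ]
    _ = _ := h'.integral_comp' F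

/-- A finite set of edges of `ℤ⁴` has bounded time coordinates. [folklore] -/
theorem exists_timeBound (s : Finset (Literature.MathematicalPhysics.QuantumLattice.ZdEdge 4)) :
    ∃ R : ℕ, ∀ e ∈ s, (e.1 0).natAbs ≤ R :=
  ⟨s.sup fun e => (e.1 0).natAbs, fun _ he =>
    Finset.le_sup (f := fun e : Literature.MathematicalPhysics.QuantumLattice.ZdEdge 4 => (e.1 0).natAbs) he⟩

/-- The `val` of a small non-negative integer cast into `ZMod N`. [folklore] -/
theorem val_intCast_of_nonneg_lt {N : ℕ} [NeZero N] (z : ℤ) (hz : 0 ≤ z) (hzN : z.toNat < N) :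
    ((z : ZMod N)).val = z.toNat := by
  have h : (z : ZMod N) = ((z.toNat : ℕ) : ZMod N) := by
    rw [← Int.cast_natCast, Int.toNat_of_nonneg hz]
  rw [h, ZMod.val_natCast, Nat.mod_eq_of_lt hzN]

/-- Relabelling invariance of the cyclic Boltzmann product under a translation of the time cycle. [folklore] -/
theorem prod_rotate_cycle {N : ℕ} [NeZero N] {X Y : Type*} (f : X → Y → X → ℝ) (c₀ : ZMod N)
    (q : (ZMod N → X) × (ZMod N → Y)) :
    ∏ t : ZMod N, f (q.1 (t + c₀)) (q.2 (t + c₀)) (q.1 (t + 1 + c₀)) = ∏ t : ZMod N, f (q.1 t) (q.2 t) (q.1 (t + 1)) :=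
  Fintype.prod_equiv (Equiv.addRight c₀) _ _ fun t => by simp only [Equiv.coe_addRight, add_right_comm]

/-- The Boltzmann weight of a sliced action is the cyclic product of the symmetrised one-step factors. [folklore] -/
theorem exp_neg_mul_sum_eq_prod {N : ℕ} [NeZero N] {X Y : Type*} (S₃ : X → ℝ) (Stm : X → Y → X → ℝ) (β : ℝ)
    (U : ZMod N → X) (g : ZMod N → Y) :
    Real.exp (-β * ∑ t : ZMod N, (S₃ (U t) + Stm (U t) (g t) (U (t + 1)))) =
      ∏ t : ZMod N, Real.exp (-(β * S₃ (U t) / 2)) * Real.exp (-(β * Stm (U t) (g t) (U (t + 1)))) * Real.exp (-(β * S₃ (U (t + 1)) / 2)) := by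
  rw [Finset.mul_sum, Real.exp_sum]
  have h1 : ∀ t : ZMod N, Real.exp (-β * (S₃ (U t) + Stm (U t) (g t) (U (t + 1)))) =
      Real.exp (-β * S₃ (U t)) * Real.exp (-(β * Stm (U t) (g t) (U (t + 1)))) := fun t => by
    rw [← Real.exp_add]; ring_nf
  simp_rw [h1]
  rw [Finset.prod_mul_distrib]
  have h2 := prod_exp_mul_prod_eq_prod_symm (L₀ := N) (fun a : X × Y => S₃ a.1)
    (fun a b : X × Y => Real.exp (-(β * Stm a.1 a.2 b.1))) (-β) (fun t => (U t, g t))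
  simp only at h2
  rw [h2]
  refine Finset.prod_congr rfl fun t _ => ?_
  congr 2 <;> ring_nf

/-- `stub_transferRepresentation` (S6a, the glue) — **torus Wilson expectations are normalised transfer traces;
finite models** (Osterwalder–Seiler 1978 §§2–3, Lüscher 1977), assembled from T1, T2, T4, T3a, T3b: see the
module docstring. [folklore] -/
theorem stub_transferRepresentation :
    ∀ (G : Type) [Group G] [TopologicalSpace G] [IsTopologicalGroup G] [CompactSpace G]
      [MeasurableSpace G] [BorelSpace G] (r : LatticeRep G) (A B : YMSpecies G),
    ∃ w : ℕ, ∀ (β : ℝ), 0 ≤ β → ∀ (CA CB : ℝ), (∀ U, |A.F U| ≤ CA) → (∀ U, |B.F U| ≤ CB) →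
      ∀ (S' n : ℕ), n ≤ S' → w < n → 2 * w ≤ S' → ∀ ε : ℝ, 0 < ε → ∃ (d : ℕ) (T Ao Bo : EuclideanSpace ℝ (Fin d) →L[ℝ] EuclideanSpace ℝ (Fin d)) (Ω : EuclideanSpace ℝ (Fin d)),
          T.IsPositive ∧ ‖Ω‖ = 1 ∧ T Ω = Ω ∧ (∀ v, inner ℝ Ω v = 0 → ‖T v‖ ≤ ‖v‖) ∧ ‖Ao‖ ≤ CA ∧ ‖Bo‖ ≤ CB ∧
          (∀ m : ℕ, LinearMap.trace ℝ _ (↑(T ^ (m + 2)) : EuclideanSpace ℝ (Fin d) →ₗ[ℝ] EuclideanSpace ℝ (Fin d)) - 1 ≤ traceExcess r.ρ β (2 * S' + 1) (m + 2)) ∧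
          |latticeConnectedCorr r.ρ β (2 * S' + 1) A.F B.F n - (LinearMap.trace ℝ _ (↑(T ^ (2 * S' + 1 - n - w) * Ao * T ^ (n - w) * Bo) : EuclideanSpace ℝ (Fin d) →ₗ[ℝ] EuclideanSpace ℝ (Fin d)) / LinearMap.trace ℝ _ (↑(T ^ (2 * S' + 1)) : EuclideanSpace ℝ (Fin d) →ₗ[ℝ] EuclideanSpace ℝ (Fin d)) - LinearMap.trace ℝ _ (↑(T ^ (2 * S' + 1 - w) * Ao) : EuclideanSpace ℝ (Fin d) →ₗ[ℝ] EuclideanSpace ℝ (Fin d)) / LinearMap.trace ℝ _ (↑(T ^ (2 * S' + 1)) : EuclideanSpace ℝ (Fin d) →ₗ[ℝ] EuclideanSpace ℝ (Fin d)) * (LinearMap.trace ℝ _ (↑(T ^ (2 * S' + 1 - w) * Bo) : EuclideanSpace ℝ (Fin d) →ₗ[ℝ] EuclideanSpace ℝ (Fin d)) / LinearMap.trace ℝ _ (↑(T ^ (2 * S' + 1)) : EuclideanSpace ℝ (Fin d) →ₗ[ℝ] EuclideanSpace ℝ (Fin d))))| ≤ ε := by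
  intro G _ _ _ _ _ _ r A B
  haveI : SecondCountableTopology G :=
    (r.continuous.isClosedEmbedding r.injective).isEmbedding.secondCountableTopology
  obtain ⟨R, hR⟩ := exists_timeBound (A.supp ∪ B.supp)
  refine ⟨2 * R + 2, ?_⟩
  intro β hβ CA CB hCA hCB S' n hn hwn h2w ε hε
  -- arithmetic of the layout
  set rb : ℕ := 2 * R with hrb
  set a : ℕ := n - rb - 3 with ha
  set b' : ℕ := 2 * S' - n - rb - 2 with hb'
  have hN : 2 * S' + 1 = 2 * rb + a + b' + 4 + 2 := by omega
  have hna : rb + a + 3 = n := by omega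
  -- the assembling map, rotations of the time cycle, extension of a window, block observables
  set asm : (ZMod (2 * S' + 1) → GaugeConfig 3 (2 * S' + 1) G) × (ZMod (2 * S' + 1) → Site 3 (2 * S' + 1) → G) →
      GaugeConfig 4 (2 * S' + 1) G := fun p => fun e : Edge 4 (2 * S' + 1) =>
        (Fin.cons (p.2 (e.1 0) (Fin.tail e.1)) (fun i : Fin 3 => p.1 (e.1 0) (Fin.tail e.1, i)) : Fin 4 → G) e.2 with hasm_def
  set rot : ZMod (2 * S' + 1) →
      (ZMod (2 * S' + 1) → GaugeConfig 3 (2 * S' + 1) G) × (ZMod (2 * S' + 1) → Site 3 (2 * S' + 1) → G) →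
      (ZMod (2 * S' + 1) → GaugeConfig 3 (2 * S' + 1) G) × (ZMod (2 * S' + 1) → Site 3 (2 * S' + 1) → G) :=
    fun c₀ p => (fun τ => p.1 (τ + c₀), fun τ => p.2 (τ + c₀)) with hrot_def
  set ext0 : (Fin (rb + 2) → GaugeConfig 3 (2 * S' + 1) G) × (Fin (rb + 1) → Site 3 (2 * S' + 1) → G) →
      (ZMod (2 * S' + 1) → GaugeConfig 3 (2 * S' + 1) G) × (ZMod (2 * S' + 1) → Site 3 (2 * S' + 1) → G) :=
    fun q => (fun τ => if h : τ.val < rb + 2 then q.1 ⟨τ.val, h⟩ else q.1 0,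
      fun τ => if h : τ.val < rb + 1 then q.2 ⟨τ.val, h⟩ else q.2 0) with hext0_def
  set blk : YMSpecies G → (Fin (rb + 2) → GaugeConfig 3 (2 * S' + 1) G) → (Fin (rb + 1) → Site 3 (2 * S' + 1) → G) → ℝ :=
    fun O W γs => O.F (torusLift (2 * S' + 1) (asm (rot (R : ZMod (2 * S' + 1)) (ext0 (W, γs))))) with hblk_def
  -- slice data (T2) and slicing (T1)
  obtain ⟨hk_meas, hk_le, hs_meas, hs_le, hK_sm, hK_symm, hK_bd, hK_pt⟩ := stub_sliceKernel G r (2 * S' + 1) β hβ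
  obtain ⟨hasm, hact⟩ := stub_timeSlicing (2 * S' + 1) G r.ρ
  have hasm_meas : Measurable asm := hasm.measurable
  have hrot_meas : ∀ c₀, Measurable (rot c₀) := fun c₀ =>
    (measurable_pi_lambda _ fun τ => (measurable_pi_apply _).comp measurable_fst).prodMk
      (measurable_pi_lambda _ fun τ => (measurable_pi_apply _).comp measurable_snd)
  have hext0_meas : Measurable ext0 := by
    refine (measurable_pi_lambda _ fun τ => ?_).prodMk (measurable_pi_lambda _ fun τ => ?_)
    · by_cases h : τ.val < rb + 2
      · simp only [h, dite_true]; exact (measurable_pi_apply _).comp measurable_fst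
      · simp only [h, dite_false]; exact (measurable_pi_apply _).comp measurable_fst
    · by_cases h : τ.val < rb + 1
      · simp only [h, dite_true]; exact (measurable_pi_apply _).comp measurable_snd
      · simp only [h, dite_false]; exact (measurable_pi_apply _).comp measurable_snd
  have hblk_meas : ∀ O : YMSpecies G,
      Measurable fun q : (Fin (rb + 2) → GaugeConfig 3 (2 * S' + 1) G) × (Fin (rb + 1) → Site 3 (2 * S' + 1) → G) =>
        blk O q.1 q.2 := fun O =>
    O.measurable.comp ((measurable_torusLift _).comp (hasm_meas.comp ((hrot_meas _).comp hext0_meas)))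
  have hblkA : ∀ W γs, |blk A W γs| ≤ CA := fun W γs => hCA _
  have hblkB : ∀ W γs, |blk B W γs| ≤ CB := fun W γs => hCB _
  -- the cylinder property puts the rotated observables in block form
  have hNR : rb + 2 ≤ 2 * S' + 1 := by omega
  have hcyl : ∀ (O : YMSpecies G), (∀ e ∈ O.supp, (e.1 0).natAbs ≤ R) →
      ∀ (m : ℕ) (q : (ZMod (2 * S' + 1) → GaugeConfig 3 (2 * S' + 1) G) × (ZMod (2 * S' + 1) → Site 3 (2 * S' + 1) → G)),
      O.F (configShift (-Pi.single 0 (m : ℤ)) (torusLift (2 * S' + 1) (asm (rot (R : ZMod (2 * S' + 1)) q)))) = blk O (fun i : Fin (rb + 2) => q.1 ((m + (i : ℕ) : ℕ) : ZMod (2 * S' + 1)))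
          (fun i : Fin (rb + 1) => q.2 ((m + (i : ℕ) : ℕ) : ZMod (2 * S' + 1))) := by
    intro O hO m q
    simp only [hblk_def]
    apply O.isCylinder
    intro e he
    obtain ⟨x, μ⟩ := e
    have hx : (x 0).natAbs ≤ R := hO _ he
    rw [configShift_apply, torusLift_apply, torusLift_apply]
    -- the time coordinates read on both sides
    have htime : Literature.Probability.LatticeModels.Torus.proj (2 * S' + 1) (x - -Pi.single 0 (m : ℤ)) 0 = ((x 0 : ℤ) : ZMod (2 * S' + 1)) + (m : ZMod (2 * S' + 1)) := by
      show (((x - -Pi.single (0 : Fin 4) (m : ℤ) : Literature.Probability.LatticeModels.Site 4) 0 : ℤ) : ZMod (2 * S' + 1)) = _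
      rw [Pi.sub_apply, Pi.neg_apply, Pi.single_eq_same]
      push_cast
      ring
    have htail : Fin.tail (Literature.Probability.LatticeModels.Torus.proj (2 * S' + 1) (x - -Pi.single 0 (m : ℤ))) = Fin.tail (Literature.Probability.LatticeModels.Torus.proj (2 * S' + 1) x) := by
      funext i
      show (((x - -Pi.single (0 : Fin 4) (m : ℤ) : Literature.Probability.LatticeModels.Site 4) i.succ : ℤ) : ZMod (2 * S' + 1)) = ((x i.succ : ℤ) : ZMod (2 * S' + 1))
      rw [Pi.sub_apply, Pi.neg_apply, Pi.single_eq_of_ne (Fin.succ_ne_zero i), neg_zero, sub_zero]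
    have htime0 : Literature.Probability.LatticeModels.Torus.proj (2 * S' + 1) x 0 = ((x 0 : ℤ) : ZMod (2 * S' + 1)) := rfl
    -- the window index
    have hz0 : 0 ≤ x 0 + R := by omega
    have hzt : (x 0 + R).toNat ≤ rb := by omega
    have hval : (((x 0 : ℤ) : ZMod (2 * S' + 1)) + (R : ZMod (2 * S' + 1))).val = (x 0 + R).toNat := by
      have h := val_intCast_of_nonneg_lt (N := 2 * S' + 1) (x 0 + R) hz0 (by omega)
      rw [← h]
      push_cast
      rfl
    have hlt1 : (((x 0 : ℤ) : ZMod (2 * S' + 1)) + (R : ZMod (2 * S' + 1))).val < rb + 1 := by rw [hval]; omega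
    have hlt2 : (((x 0 : ℤ) : ZMod (2 * S' + 1)) + (R : ZMod (2 * S' + 1))).val < rb + 2 := by rw [hval]; omega
    have hidx : ((m + (((x 0 : ℤ) : ZMod (2 * S' + 1)) + (R : ZMod (2 * S' + 1))).val : ℕ) : ZMod (2 * S' + 1)) =
        ((x 0 : ℤ) : ZMod (2 * S' + 1)) + (m : ZMod (2 * S' + 1)) + (R : ZMod (2 * S' + 1)) := by
      push_cast
      rw [ZMod.natCast_zmod_val]
      ring
    simp only [hasm_def, hrot_def, hext0_def]
    refine Fin.cases ?_ (fun i => ?_) μ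
    · simp only [Fin.cons_zero]
      rw [htime, htail, htime0, dif_pos hlt1, hidx]
    · simp only [Fin.cons_succ]
      rw [htime, htail, htime0, dif_pos hlt2, hidx]
  have hRA : ∀ e ∈ A.supp, (e.1 0).natAbs ≤ R := fun e he => hR e (Finset.mem_union_left _ he)
  have hRB : ∀ e ∈ B.supp, (e.1 0).natAbs ≤ R := fun e he => hR e (Finset.mem_union_right _ he)
  have hshift0 : ∀ V : LGConfig 4 G, configShift (0 : Literature.Probability.LatticeModels.Site 4) V = V :=
    fun V => by funext e; rw [configShift_apply, sub_zero]
  have hcyl0 : ∀ (O : YMSpecies G), (∀ e ∈ O.supp, (e.1 0).natAbs ≤ R) →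
      ∀ q : (ZMod (2 * S' + 1) → GaugeConfig 3 (2 * S' + 1) G) × (ZMod (2 * S' + 1) → Site 3 (2 * S' + 1) → G),
      O.F (torusLift (2 * S' + 1) (asm (rot (R : ZMod (2 * S' + 1)) q))) = blk O (fun i : Fin (rb + 2) => q.1 (((i : ℕ) : ℕ) : ZMod (2 * S' + 1)))
          (fun i : Fin (rb + 1) => q.2 (((i : ℕ) : ℕ) : ZMod (2 * S' + 1))) := by
    intro O hO q
    have h := hcyl O hO 0 q
    simp only [Nat.cast_zero, Pi.single_zero, neg_zero, hshift0, zero_add] at h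
    exact h
  -- the one-step Boltzmann factor `c` and the fibre-averaged kernel
  have hc_meas : Measurable fun q : GaugeConfig 3 (2 * S' + 1) G × (Site 3 (2 * S' + 1) → G) × GaugeConfig 3 (2 * S' + 1) G =>
      Real.exp (-(β * wilsonAction r.ρ q.1 / 2)) * Real.exp (-(β * sliceTemporalAction r.ρ q.1 q.2.1 q.2.2)) * Real.exp (-(β * wilsonAction r.ρ q.2.2 / 2)) :=
    ((hs_meas.comp measurable_fst).mul hk_meas).mul (hs_meas.comp (measurable_snd.comp measurable_snd))
  have hc_bd : ∀ (x : GaugeConfig 3 (2 * S' + 1) G) (γ : Site 3 (2 * S' + 1) → G) (x' : GaugeConfig 3 (2 * S' + 1) G),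
      0 ≤ Real.exp (-(β * wilsonAction r.ρ x / 2)) * Real.exp (-(β * sliceTemporalAction r.ρ x γ x')) * Real.exp (-(β * wilsonAction r.ρ x' / 2)) ∧
        Real.exp (-(β * wilsonAction r.ρ x / 2)) * Real.exp (-(β * sliceTemporalAction r.ρ x γ x')) * Real.exp (-(β * wilsonAction r.ρ x' / 2)) ≤ 1 := fun x γ x' =>
    ⟨by positivity, mul_le_one₀ (mul_le_one₀ (hs_le x) (Real.exp_pos _).le (hk_le x γ x')) (Real.exp_pos _).le (hs_le x')⟩
  have hKc : ∀ x x' : GaugeConfig 3 (2 * S' + 1) G,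
      ∫ γ, Real.exp (-(β * wilsonAction r.ρ x / 2)) * Real.exp (-(β * sliceTemporalAction r.ρ x γ x')) *
          Real.exp (-(β * wilsonAction r.ρ x' / 2)) ∂(Measure.pi fun _ : Site 3 (2 * S' + 1) => haarProbability G) = wilsonSliceKernel r.ρ β x x' := by
    intro x x'
    unfold wilsonSliceKernel
    rw [integral_mul_const, integral_const_mul]
  -- slicing the four Haar integrals
  have hact' : ∀ p : (ZMod (2 * S' + 1) → GaugeConfig 3 (2 * S' + 1) G) × (ZMod (2 * S' + 1) → Site 3 (2 * S' + 1) → G),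
      wilsonAction r.ρ (asm p) = ∑ t : ZMod (2 * S' + 1), (wilsonAction r.ρ (p.1 t) + sliceTemporalAction r.ρ (p.1 t) (p.2 t) (p.1 (t + 1))) := fun p => hact p.1 p.2
  have hnum : ∀ Φ : GaugeConfig 4 (2 * S' + 1) G → ℝ, Measurable Φ →
      ∫ U, Φ U * Real.exp (-β * wilsonAction r.ρ U) ∂(Measure.pi fun _ : Edge 4 (2 * S' + 1) => haarProbability G) = ∫ p, Φ (asm p) * ∏ t : ZMod (2 * S' + 1),
          (Real.exp (-(β * wilsonAction r.ρ (p.1 t) / 2)) * Real.exp (-(β * sliceTemporalAction r.ρ (p.1 t) (p.2 t) (p.1 (t + 1)))) * Real.exp (-(β * wilsonAction r.ρ (p.1 (t + 1)) / 2)))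
          ∂((Measure.pi fun _ : ZMod (2 * S' + 1) => Measure.pi fun _ : Edge 3 (2 * S' + 1) => haarProbability G).prod
            (Measure.pi fun _ : ZMod (2 * S' + 1) => Measure.pi fun _ : Site 3 (2 * S' + 1) => haarProbability G)) := by
    intro Φ hΦ
    have hmeas : Measurable fun U : GaugeConfig 4 (2 * S' + 1) G => Φ U * Real.exp (-β * wilsonAction r.ρ U) :=
      hΦ.mul (Real.measurable_exp.comp ((measurable_wilsonAction r.ρ r.continuous).const_mul (-β)))
    rw [← hasm.map_eq, integral_map hasm_meas.aemeasurable hmeas.aestronglyMeasurable]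
    refine integral_congr_ae (ae_of_all _ fun p => ?_)
    dsimp only
    rw [hact' p, exp_neg_mul_sum_eq_prod]
  have hE : ∀ Φ : GaugeConfig 4 (2 * S' + 1) G → ℝ, Measurable Φ →
      ∫ U, Φ U ∂(wilsonMeasure r.ρ β) = (∫ p, Φ (asm p) * ∏ t : ZMod (2 * S' + 1), (Real.exp (-(β * wilsonAction r.ρ (p.1 t) / 2)) *
            Real.exp (-(β * sliceTemporalAction r.ρ (p.1 t) (p.2 t) (p.1 (t + 1)))) * Real.exp (-(β * wilsonAction r.ρ (p.1 (t + 1)) / 2)))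
          ∂((Measure.pi fun _ : ZMod (2 * S' + 1) => Measure.pi fun _ : Edge 3 (2 * S' + 1) => haarProbability G).prod
            (Measure.pi fun _ : ZMod (2 * S' + 1) => Measure.pi fun _ : Site 3 (2 * S' + 1) => haarProbability G))) / ∫ p, ∏ t : ZMod (2 * S' + 1),
          (Real.exp (-(β * wilsonAction r.ρ (p.1 t) / 2)) * Real.exp (-(β * sliceTemporalAction r.ρ (p.1 t) (p.2 t) (p.1 (t + 1)))) * Real.exp (-(β * wilsonAction r.ρ (p.1 (t + 1)) / 2)))
          ∂((Measure.pi fun _ : ZMod (2 * S' + 1) => Measure.pi fun _ : Edge 3 (2 * S' + 1) => haarProbability G).prod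
            (Measure.pi fun _ : ZMod (2 * S' + 1) => Measure.pi fun _ : Site 3 (2 * S' + 1) => haarProbability G)) := by
    intro Φ hΦ
    have h := wilsonExpectation_eq_div_integral (L := 2 * S' + 1) (ρ := r.ρ) r.continuous β Φ
    unfold wilsonExpectation at h
    rw [h, hnum Φ hΦ]
    have h1 := hnum (fun _ => (1 : ℝ)) measurable_const
    simp only [one_mul] at h1
    rw [h1]
  -- measurability of the three observables on the torus
  have hmA : Measurable fun U : GaugeConfig 4 (2 * S' + 1) G => A.F (torusLift (2 * S' + 1) U) :=
    A.measurable.comp (measurable_torusLift _)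
  have hmB : Measurable fun U : GaugeConfig 4 (2 * S' + 1) G => B.F (torusLift (2 * S' + 1) U) :=
    B.measurable.comp (measurable_torusLift _)
  have hmBn : Measurable fun U : GaugeConfig 4 (2 * S' + 1) G =>
      B.F (configShift (-Pi.single 0 (n : ℤ)) (torusLift (2 * S' + 1) U)) :=
    B.measurable.comp ((configShift _).measurable.comp (measurable_torusLift _))
  have hmAB : Measurable fun U : GaugeConfig 4 (2 * S' + 1) G =>
      A.F (torusLift (2 * S' + 1) U) * B.F (configShift (-Pi.single 0 (n : ℤ)) (torusLift (2 * S' + 1) U)) :=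
    hmA.mul hmBn
  -- rotations
  have hrotInt : ∀ (c₀ : ZMod (2 * S' + 1))
      (F : (ZMod (2 * S' + 1) → GaugeConfig 3 (2 * S' + 1) G) × (ZMod (2 * S' + 1) → Site 3 (2 * S' + 1) → G) → ℝ),
      ∫ q, F (rot c₀ q) ∂((Measure.pi fun _ : ZMod (2 * S' + 1) => Measure.pi fun _ : Edge 3 (2 * S' + 1) => haarProbability G).prod
            (Measure.pi fun _ : ZMod (2 * S' + 1) => Measure.pi fun _ : Site 3 (2 * S' + 1) => haarProbability G)) =
        ∫ p, F p ∂((Measure.pi fun _ : ZMod (2 * S' + 1) => Measure.pi fun _ : Edge 3 (2 * S' + 1) => haarProbability G).prod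
            (Measure.pi fun _ : ZMod (2 * S' + 1) => Measure.pi fun _ : Site 3 (2 * S' + 1) => haarProbability G)) :=
    fun c₀ F => integral_rotate_cycle _ _ c₀ F
  have hprod_rot : ∀ (c₀ : ZMod (2 * S' + 1))
      (q : (ZMod (2 * S' + 1) → GaugeConfig 3 (2 * S' + 1) G) × (ZMod (2 * S' + 1) → Site 3 (2 * S' + 1) → G)),
      ∏ t : ZMod (2 * S' + 1), (Real.exp (-(β * wilsonAction r.ρ ((rot c₀ q).1 t) / 2)) * Real.exp (-(β * sliceTemporalAction r.ρ ((rot c₀ q).1 t) ((rot c₀ q).2 t) ((rot c₀ q).1 (t + 1)))) *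
            Real.exp (-(β * wilsonAction r.ρ ((rot c₀ q).1 (t + 1)) / 2))) = ∏ t : ZMod (2 * S' + 1), (Real.exp (-(β * wilsonAction r.ρ (q.1 t) / 2)) *
            Real.exp (-(β * sliceTemporalAction r.ρ (q.1 t) (q.2 t) (q.1 (t + 1)))) * Real.exp (-(β * wilsonAction r.ρ (q.1 (t + 1)) / 2))) := fun c₀ q =>
    prod_rotate_cycle (fun x y x' => Real.exp (-(β * wilsonAction r.ρ x / 2)) *
      Real.exp (-(β * sliceTemporalAction r.ρ x y x')) * Real.exp (-(β * wilsonAction r.ρ x' / 2))) c₀ q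
  -- T4: slab contraction
  have hT4 := stub_slabContraction (GaugeConfig 3 (2 * S' + 1) G) (Site 3 (2 * S' + 1) → G)
    (Measure.pi fun _ : Edge 3 (2 * S' + 1) => haarProbability G) (Measure.pi fun _ : Site 3 (2 * S' + 1) => haarProbability G)
    (fun U g U' => Real.exp (-(β * wilsonAction r.ρ U / 2)) * Real.exp (-(β * sliceTemporalAction r.ρ U g U')) *
      Real.exp (-(β * wilsonAction r.ρ U' / 2))) 1 hc_meas hc_bd rb a b' (2 * S' + 1) hN
  obtain ⟨⟨hXa_sm, hXb_sm⟩, hdom, hbdX, h2, h1a, h0⟩ := hT4 (blk A) (blk B) CA CB (hblk_meas A) (hblk_meas B) hblkA hblkB _ _ _ (fun _ _ => rfl) (fun _ _ => rfl) (fun _ _ => rfl)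
  obtain ⟨-, -, -, -, h1b, -⟩ := hT4 (blk B) (blk B) CB CB (hblk_meas B) (hblk_meas B) hblkB hblkB _ _ _ (fun _ _ => rfl) (fun _ _ => rfl) (fun _ _ => rfl)
  rw [hna] at h2
  -- the correlation as a ratio of contracted cyclic integrals
  have hcorr := (rfl : latticeConnectedCorr r.ρ β (2 * S' + 1) A.F B.F n = _)
  conv_rhs at hcorr => unfold latticeConnectedCorr
  rw [hE _ hmAB, hE _ hmA, hE _ hmB] at hcorr
  rw [← hrotInt (R : ZMod (2 * S' + 1)) (fun p => A.F (torusLift (2 * S' + 1) (asm p)) *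
      B.F (configShift (-Pi.single 0 (n : ℤ)) (torusLift (2 * S' + 1) (asm p))) * ∏ t : ZMod (2 * S' + 1), (Real.exp (-(β * wilsonAction r.ρ (p.1 t) / 2)) *
          Real.exp (-(β * sliceTemporalAction r.ρ (p.1 t) (p.2 t) (p.1 (t + 1)))) * Real.exp (-(β * wilsonAction r.ρ (p.1 (t + 1)) / 2)))),
    ← hrotInt (R : ZMod (2 * S' + 1)) (fun p => A.F (torusLift (2 * S' + 1) (asm p)) * ∏ t : ZMod (2 * S' + 1), (Real.exp (-(β * wilsonAction r.ρ (p.1 t) / 2)) *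
          Real.exp (-(β * sliceTemporalAction r.ρ (p.1 t) (p.2 t) (p.1 (t + 1)))) * Real.exp (-(β * wilsonAction r.ρ (p.1 (t + 1)) / 2)))),
    ← hrotInt (R : ZMod (2 * S' + 1)) (fun p => B.F (torusLift (2 * S' + 1) (asm p)) * ∏ t : ZMod (2 * S' + 1), (Real.exp (-(β * wilsonAction r.ρ (p.1 t) / 2)) *
          Real.exp (-(β * sliceTemporalAction r.ρ (p.1 t) (p.2 t) (p.1 (t + 1)))) * Real.exp (-(β * wilsonAction r.ρ (p.1 (t + 1)) / 2))))] at hcorr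
  simp only [hcyl0 A hRA, hcyl0 B hRB, hcyl B hRB n, hprod_rot] at hcorr
  rw [h2, h1a, h1b, h0] at hcorr
  -- T3a: spectral data of the fibre-averaged kernel (kernel facts from T2 through `hKc`)
  have hKfun : (fun x x' : GaugeConfig 3 (2 * S' + 1) G =>
      ∫ γ, Real.exp (-(β * wilsonAction r.ρ x / 2)) * Real.exp (-(β * sliceTemporalAction r.ρ x γ x')) *
          Real.exp (-(β * wilsonAction r.ρ x' / 2)) ∂(Measure.pi fun _ : Site 3 (2 * S' + 1) => haarProbability G)) =
      wilsonSliceKernel r.ρ β := by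
    funext x x'; exact hKc x x'
  have hK_sm' : StronglyMeasurable (Function.uncurry fun x x' : GaugeConfig 3 (2 * S' + 1) G =>
      ∫ γ, Real.exp (-(β * wilsonAction r.ρ x / 2)) * Real.exp (-(β * sliceTemporalAction r.ρ x γ x')) *
          Real.exp (-(β * wilsonAction r.ρ x' / 2)) ∂(Measure.pi fun _ : Site 3 (2 * S' + 1) => haarProbability G)) := by
    rw [hKfun]; exact hK_sm
  have hK_symm' : ∀ x y : GaugeConfig 3 (2 * S' + 1) G,
      (∫ γ, Real.exp (-(β * wilsonAction r.ρ x / 2)) * Real.exp (-(β * sliceTemporalAction r.ρ x γ y)) *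
          Real.exp (-(β * wilsonAction r.ρ y / 2)) ∂(Measure.pi fun _ : Site 3 (2 * S' + 1) => haarProbability G)) =
        ∫ γ, Real.exp (-(β * wilsonAction r.ρ y / 2)) * Real.exp (-(β * sliceTemporalAction r.ρ y γ x)) *
          Real.exp (-(β * wilsonAction r.ρ x / 2)) ∂(Measure.pi fun _ : Site 3 (2 * S' + 1) => haarProbability G) :=
    fun x y => by rw [hKc, hKc]; exact hK_symm x y
  have hK_bd' : ∀ x y : GaugeConfig 3 (2 * S' + 1) G,
      0 < (∫ γ, Real.exp (-(β * wilsonAction r.ρ x / 2)) * Real.exp (-(β * sliceTemporalAction r.ρ x γ y)) *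
          Real.exp (-(β * wilsonAction r.ρ y / 2)) ∂(Measure.pi fun _ : Site 3 (2 * S' + 1) => haarProbability G)) ∧
        (∫ γ, Real.exp (-(β * wilsonAction r.ρ x / 2)) * Real.exp (-(β * sliceTemporalAction r.ρ x γ y)) *
          Real.exp (-(β * wilsonAction r.ρ y / 2)) ∂(Measure.pi fun _ : Site 3 (2 * S' + 1) => haarProbability G)) ≤ 1 :=
    fun x y => by rw [hKc]; exact hK_bd x y
  have hK_pt' : ∀ f : GaugeConfig 3 (2 * S' + 1) G → ℝ, Measurable f → (∀ x, |f x| ≤ 1) →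
      0 ≤ ∫ x, ∫ y, f x * (∫ γ, Real.exp (-(β * wilsonAction r.ρ x / 2)) * Real.exp (-(β * sliceTemporalAction r.ρ x γ y)) *
          Real.exp (-(β * wilsonAction r.ρ y / 2)) ∂(Measure.pi fun _ : Site 3 (2 * S' + 1) => haarProbability G)) * f y
        ∂(Measure.pi fun _ : Edge 3 (2 * S' + 1) => haarProbability G) ∂(Measure.pi fun _ : Edge 3 (2 * S' + 1) => haarProbability G) := by
    intro f hf h1
    simp_rw [hKc]
    exact hK_pt f hf h1
  obtain ⟨ι, hι, bH, lam, i₀, Aop, Bop, hlam, hlam0, hlam2, hAop, hBop, hlimsup, hZsum, hS2, hS1a, hS1b⟩ :=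
    stub_spectralData (GaugeConfig 3 (2 * S' + 1) G) (Measure.pi fun _ : Edge 3 (2 * S' + 1) => haarProbability G)
      (fun x x' : GaugeConfig 3 (2 * S' + 1) G =>
        ∫ γ, Real.exp (-(β * wilsonAction r.ρ x / 2)) * Real.exp (-(β * sliceTemporalAction r.ρ x γ x')) *
          Real.exp (-(β * wilsonAction r.ρ x' / 2)) ∂(Measure.pi fun _ : Site 3 (2 * S' + 1) => haarProbability G))
      1 hK_sm' hK_symm' hK_bd' hK_pt' rb _ _ CA CB (max (CA * 1 ^ (rb + 1)) (CB * 1 ^ (rb + 1))) hXa_sm hXb_sm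
      (fun u u' => ⟨(hbdX u u').1.trans (le_max_left _ _), (hbdX u u').2.trans (le_max_right _ _)⟩)
      (fun u u' => (hdom u u').1) (fun u u' => (hdom u u').2) a b'
  -- T3b: finite models
  haveI : Countable ι := hι
  obtain ⟨d, T, Ao, Bo, Ω, hTpos, hΩ, hTΩ, hcontr, hT1, hAo, hBo, htr, hclose⟩ :=
    stub_finiteTruncation (Lp ℝ 2 (Measure.pi fun _ : Edge 3 (2 * S' + 1) => haarProbability G)) ι bH lam i₀ Aop Bop
      CA CB rb a b' hlam hlam0 hlam2 hAop hBop ε hε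
  refine ⟨d, T, T * Ao, T * Bo, Ω, hTpos, hΩ, hTΩ, hcontr, ?_, ?_, ?_, ?_⟩
  · calc ‖T * Ao‖ ≤ ‖T‖ * ‖Ao‖ := norm_mul_le T Ao
      _ ≤ 1 * ‖Ao‖ := mul_le_mul_of_nonneg_right hT1 (norm_nonneg _)
      _ ≤ CA := by rw [one_mul]; exact hAo
  · calc ‖T * Bo‖ ≤ ‖T‖ * ‖Bo‖ := norm_mul_le T Bo
      _ ≤ 1 * ‖Bo‖ := mul_le_mul_of_nonneg_right hT1 (norm_nonneg _)
      _ ≤ CB := by rw [one_mul]; exact hBo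
  · -- the trace excess of the model is dominated by the trace excess of the torus
    intro m
    have hlimsup' := hlimsup
    simp_rw [hKc] at hlimsup'
    have hlamtop : transferSpectralRadius r.ρ β (2 * S' + 1) = lam i₀ := hlimsup'
    have hZm' := hZsum m
    simp_rw [hKc] at hZm'
    have hZm : ∑' i, lam i ^ (m + 2) = cyclicPartition r.ρ β (2 * S' + 1) (m + 2) := hZm'.tsum_eq
    unfold traceExcess
    rw [hlamtop, ← hZm]
    exact htr m
  · -- the correlation
    rw [hcorr]
    have hZN := (hZsum (2 * rb + a + b' + 4)).tsum_eq
    have hS2e := hS2.tsum_eq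
    have hS1ae := hS1a.tsum_eq
    have hS1be := hS1b.tsum_eq
    beta_reduce at hZN hS2e hS1ae hS1be ⊢
    rw [← hS2e, ← hS1ae, ← hS1be, ← hZN]
    have e1 : 2 * S' + 1 - n - (rb + 2) = b' + 1 := by omega
    have e2 : n - (rb + 2) = a + 1 := by omega
    have e3 : 2 * S' + 1 - (rb + 2) = rb + a + b' + 4 := by omega
    have eN : T ^ (2 * S' + 1) = T ^ (2 * rb + a + b' + 4 + 2) := by rw [hN]
    rw [e1, e2, e3, eN]
    have hm2 : T ^ (b' + 1) * (T * Ao) * T ^ (a + 1) * (T * Bo) = T ^ (b' + 2) * Ao * T ^ (a + 2) * Bo := by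
      calc T ^ (b' + 1) * (T * Ao) * T ^ (a + 1) * (T * Bo) = (T ^ (b' + 1) * T) * Ao * ((T ^ (a + 1) * T) * Bo) := by simp only [mul_assoc]
        _ = T ^ (b' + 2) * Ao * T ^ (a + 2) * Bo := by rw [← pow_succ, ← pow_succ]; simp only [mul_assoc]
    have hm1a : T ^ (rb + a + b' + 4) * (T * Ao) = T ^ (rb + a + b' + 5) * Ao := by rw [← mul_assoc, ← pow_succ]
    have hm1b : T ^ (rb + a + b' + 4) * (T * Bo) = T ^ (rb + a + b' + 5) * Bo := by rw [← mul_assoc, ← pow_succ]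
    rw [hm2, hm1a, hm1b]
    exact hclose

end Summit.QuantumFields.YangMills.Theorems.WeakCouplingHypercubicLimit.TraceNormColdPressure

end
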